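import Summits.Langlands.Langlands.Theses.PadicReachabilityCarving
import Summits.Langlands.Langlands.Theses.RefinementCarving
import Summits.Langlands.Langlands.Theorems.IrreducibilityBySelfDualityReciprocityUpToIrreducibilityCorrespondsConj

/-!
# RefinementCarvingKernel — TREE TWIN (kernels) of the lens-6-g21 node `RefinementCarving` (decomp-langlands, D-0171/D-0178)

This file is the node HOME/nodes/lens-6-g21-RefinementCarving.RefinementCarving.lean re-namespaced under `Theorems.RefinementCarvingKernel`, with `Iff.rfl` bridges to the
BORN route `Summits.Langlands.Langlands.Theses.RefinementCarving` (route-Langlands-RefinementCarving rev 0, `--refines route-Langlands-PadicReachabilityCarving:ReachableIrregularCoreAtP`):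
the dial, the two cells REF/UNREF (texts verbatim = the born decls), the exactness kernel `ri_iff_cells`, the deciding kernels, the necessity certificates and the
BC5 finite-image rungs.  Nothing here proves `Langlands`, RI, REF or UNREF.  Original node docstring follows.

# RefinementCarving — lens-6 (barrier-complement carving), generation 21

TARGET (by name): RI = `Summit.Langlands.Langlands.Theses.PadicReachabilityCarving.ReachableIrregularCoreAtP` (stmt-Langlands-26900, crux r3 of
route-Langlands-PadicReachabilityCarving rev 0, leaf INSTRUMENTABLE/IDEA-NEEDED, never split).  RI = (DR ∣ K solvably reachable, n ≥ 2, π irregular) ∧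
(S_p ∣ same): for an L-algebraic cuspidal π of GL_n/K whose infinity type is NOT regular and an irreducible ℓ-adic ρ Satake-compatible with π at almost
all places, (DR) ρ|K_v is de Rham at every v ∣ ℓ and (S_p) the Fontaine–pst Weil–Deligne representation of ρ|K_v has the Weil traces of rec_v(π_v).

THE BARRIER AND ITS COMPLEMENT.  The obstruction recorded for RI is the v ∣ ℓ twin of `Literature.Barriers.Langlands.MonodromyNotClosedUnderPadicLimits`
(scope caveat (a) of that file, quoting A'Campo–Hevesi–Thorne–Whitmore arXiv:2607.11763 p. 5: «p-adic limits of de Rham representations need not be de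
Rham»): every known avatar of an IRREGULAR π is a p-adic LIMIT (congruences to regular forms — Taylor, Jarvis, HLTT/Scholze, Pilloni–Stroh, Goldring–
Koskivirta) and de Rham-ness / the Weil–Deligne type do not pass to limits.  The barrier file names its own evasion (AHTW §1.2.4): CLOSED conditions DO
pass to the limit, and at v ∣ ℓ the closed condition in print is Kisin's finite-slope crystalline PERIOD `D_cris(V)^{φ = α} ≠ 0` on an analytic family
(Kisin 2003, Cor. 5.15).  One period per REFINEMENT α; n INDEPENDENT periods — i.e. `dim D_cris = n`, crystalline, and then the full Frobenius-
semisimple Weil–Deligne type — exactly when the n refinements are DISTINCT.  Through rec_v: π_v is a REGULAR principal series, rec(π_v) = (χ₁ ⊕ … ⊕ χ_n,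
N = 0) with χ_i pairwise distinct.  This is hypothesis (4) of Boxer–Pilloni, Higher Coleman theory, Thm. 23 = Thm. 351 (weakly regular odd essentially
(conjugate) self-dual π over a TR/CM field: ρ|K_v potentially crystalline AND ι WD(ρ|K_v)^{F-ss} = rec(π_v ⊗ |det|^{(1-n)/2}) — both halves of T), of
Jorza MRL 19 (2012) Thm. 3.1 (GSp₄/ℚ, limit of discrete series: `dim D_cris ≥ #{distinct Satake parameters}`) and Thm. B, and Jorza records that the
complement is STRUCTURAL: «one doesn't even obtain that the representation is Hodge–Tate without this assumption» (p. 2).  So the carving is BY THE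
BARRIER'S OWN EVASION SCOPE: the cell where the closed condition has full strength, and its complement.

THE DIAL (`IsRegularlyRefinedAt π v`, inlined in the item texts): for every local component π_v and EVERY local Langlands datum L of K_v, every
F-semisimple representative S of L.rec_n(π_v) is a `RegularSplitParameter` (N = 0; diagonal in some basis of ℂⁿ with pairwise distinct diagonal
characters).  Local at v, on the automorphic side only: no Galois datum, no `Rec`, no field type (critic rule f1, row 230).  ORBIT CLOSURE: invariant
under twisting by any character (kernel `regularSplitParameter_twist_iff`); NOT invariant under restriction to W_{L_w} (a finite-order ratio χ_i/χ_j can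
die under base change: «BC-collapse») and AI-images of lower-rank parameters are never regular split unless v splits — both penumbrae are DECLARED on
UNREF (instrumentable by cyclic base change / automorphic induction, Arthur–Clozel Thms 4.2, 5.1, 6.2; not typable without a base-change relation on
`CuspidalAutomorphicRepData`, which the tree has only in the `μ`-model of `ArthurClozelBaseChange`).

PIECES (2 new cruxes; the parent's RB/UR/AB/FRAME by name only in the V-F fallback `closes`):
* REF `RefinedIrregularCoreAtP` — crux 2 · WEAKER (`Cert.ref_of_ri`, S-implied `Cert.ref_of_langlands`) · ATTACKABLE-BY-ENGINE on the polarised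
  weakly-regular odd sector over the TR/CM floor = PRINT (Boxer–Pilloni Thm. 351 (4), conditional there on Mok/KMSW; to be VENDORED — the tree's
  `HilbertPartialWeightOneGaloisRep` lists it under «What is NOT here»): partial weight one Hilbert forms (n = 2, K TR), low-weight holomorphic Siegel and
  U(a,b) forms; reachable non-floor K by solvable base change when no BC-collapse occurs.  IDEA-NEEDED off that sector: non-polarised irregular π and
  Hodge–Tate multiplicity ≥ 3 (no (limit of) discrete series, no coherent realisation: `ShimuraVarietyRealizationBarrier` technique class) — the missing
  object is a finite-slope family through π on which crystalline classical points accumulate.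
* UNREF `UnrefinedIrregularCoreAtP` — crux 3 · DECLARED RESIDUAL · WEAKER (`Cert.unref_of_ri`) · IDEA-NEEDED · BARRIER scope-caveat (a) HEAD-ON: π_v special
  / Steinberg-type (N ≠ 0: Newton 2015 §1.1 «seems to require a new idea», Moy–Specter 2015 Rem. 1.1), supercuspidal support (a constituent of dimension
  ≥ 2), non-regular principal series (colliding refinements: companion / critical-slope points).  Penumbra as above.  Nothing decided beyond the parent's
  finite-image DR rung.

KERNELS (0 sorry): `ri_iff_cells : RI ↔ REF ∧ UNREF` (one excluded middle per half — exact modulo nothing); `closes_child : REF → UNREF → RI` (the child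
route's deciding theorem, = childroute.glue.lean); `closes : REF → UNREF → RB → UR → AB → FRAME → Langlands` through the parent's landed
`PadicReachabilityCarving.closes`; necessity `Cert.{deRhamMember,semisimpleMatchingAtP,ri,ref,unref}_of_langlands`, `Cert.{ref,unref}_of_ri`; dial
algebra `regularSplitParameter_of_twist`, `regularSplitParameter_twist_iff`, `RegularSplitParameter.commute`, `.N_eq_zero`; `refined_iff_named` /
`unrefined_iff_named : … ↔ …Named := Iff.rfl`.  ≤ 1 EQUIV: exactly one (`ri_iff_cells`), with no antecedent.

WHY NOVEL (relative to the cell and the tree).  No node has cut RI (bus ≤ L1238).  The Kisin-period engine occurs in the cell only on the (B)-side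
classicality host of lens-2-g17 `ClassicalityWeightSplit` (pro-automorphic ρ ⇒ automorphic; opposite direction, different item) and in the dormant
pre-cell route `SenNullAlignment` (n = 2, K TR, partial weight one; lever = Sen-nullity at ALIGNED places, the complementary phenomenon; its crux
`NonAlignedAtEll` merely cites BP (4) for the regular-principal-series sub-case).  Delta: all n, all solvably reachable K, both halves of T, and the dial is
the period engine's exact scope typed on the local parameter — the first (A)-side p-adic node whose cell boundary is a LOCAL REPRESENTATION-THEORETIC
condition at v rather than a field-type, weight or image condition (census axes A1–A6 are all global).

WHY EACH PIECE IS STRICTLY WEAKER THAN RI / T / Langlands.  Kernel: both are restrictions of RI (`Cert.*_of_ri`).  Strictness (probes, `probesA.lean`,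
all `fail_if_success`): REF ↛ RI, UNREF ↛ RI, REF ↛ UNREF, UNREF ↛ REF, REF/UNREF ↛ T, ↛ Langlands by the light portfolio; on paper: REF says nothing at
a place where π_v is Steinberg (UNREF's first member: a partial weight one Hilbert form Steinberg at p, Newton's open case), UNREF nothing at an
unramified place with distinct Satake parameters (REF's first member: Jorza's Thm 3.1 setting one rank up).
-/

set_option linter.dupNamespace false
set_option linter.unusedVariables false

namespace Summit.Langlands.Langlands.Theorems.RefinementCarvingKernel

open Summit.Langlands.Langlands.Theses

open scoped BigOperators Topology Manifold Classical MeasureTheory ProbabilityTheory Matrix InnerProductSpace ComplexConjugate ContinuousMap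
open Filter Set Function TopologicalSpace MeasureTheory
open Literature.NumberTheory.GaloisRepresentations Literature.NumberTheory.Automorphic

/-! ## The dial — «π is REGULARLY REFINED at v»: rec(π_v) is (N = 0, a direct sum of n pairwise distinct characters of W_{K_v}) -/

section Dial

variable {F : Type} [Field F] [ValuativeRel F] [TopologicalSpace F] [IsNonarchimedeanLocalField F]

/-- A complex Weil–Deligne representation on `ℂⁿ` is a **regular split parameter** when its monodromy vanishes and its Weil representation is
DIAGONAL in some basis with PAIRWISE DISTINCT diagonal characters: `S ≅ (χ₁ ⊕ … ⊕ χ_n, N = 0)`, `χ_i ≠ χ_j` (`i ≠ j`).  Through `rec_v` this is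
exactly «`π_v` is an irreducible principal series `I(χ₁, …, χ_n)` with `χ` REGULAR», i.e. «the Jacquet module `(π_v)_U` is a direct sum of `n!`
distinct characters» — hypothesis (4) of Boxer–Pilloni, *Higher Coleman theory*, Thm. 23 = Thm. 351 [arXiv:2110.10251, p. 10 and §6.11], and (for
unramified `π_v`, `n = 4` symplectic) «the Satake parameters are distinct» of Jorza, MRL 19 (2012) Thm. 3.1 / Thm. B.  The `n` DISTINCT characters are
the `n` refinements whose finite-slope crystalline PERIODS (Kisin 2003, Cor. 5.15) are the closed condition that survives the p-adic limit at
irregular weight.  [cite: BoxerPilloni2021HigherColeman, Thm. 23 (4)] [cite: Jorza2012MRL, Thm. 3.1, Thm. B] [cite: Kisin2003, Cor. 5.15] -/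
def RegularSplitParameter {n : ℕ} (S : WeilDeligneRep F ℂ (Fin n → ℂ)) : Prop :=
  S.N = 0 ∧ ∃ (b : Module.Basis (Fin n) ℂ (Fin n → ℂ)) (χ : Fin n → WeilGroup F → ℂ), Function.Injective χ ∧
    ∀ (i : Fin n) (w : WeilGroup F), S.ρ w (b i) = χ i w • b i

/-- **Twist-closure of the dial** (orbit-closure certificate, critic rule of rows 6/19): a scalar twist `S' = S ⊗ μ` by ANY function
`μ : W_F → ℂˣ` (in particular by `rec₁` of the local component of an algebraic Hecke character, ramified or not) with the same monodromy is a
regular split parameter iff `S` is: same eigenbasis, characters `μ·χ_i`, still pairwise distinct. [folklore] -/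
theorem regularSplitParameter_of_twist {n : ℕ} {S S' : WeilDeligneRep F ℂ (Fin n → ℂ)} (μ : WeilGroup F → ℂˣ)
    (hN : S'.N = S.N) (hρ : ∀ (w : WeilGroup F) (x : Fin n → ℂ), S'.ρ w x = (μ w : ℂ) • S.ρ w x) :
    RegularSplitParameter S → RegularSplitParameter S' := by
  rintro ⟨hN0, b, χ, hinj, hdiag⟩
  refine ⟨hN.trans hN0, b, fun i w => (μ w : ℂ) * χ i w, ?_, fun i w => by rw [hρ, hdiag, smul_smul]⟩
  intro i j hij
  apply hinj
  funext w
  have h := congrFun hij w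
  exact mul_left_cancel₀ (μ w).ne_zero h

/-- … and conversely (twist back by `μ⁻¹`), so the dial is INVARIANT under twisting. [folklore] -/
theorem regularSplitParameter_twist_iff {n : ℕ} {S S' : WeilDeligneRep F ℂ (Fin n → ℂ)} (μ : WeilGroup F → ℂˣ)
    (hN : S'.N = S.N) (hρ : ∀ (w : WeilGroup F) (x : Fin n → ℂ), S'.ρ w x = (μ w : ℂ) • S.ρ w x) :
    RegularSplitParameter S' ↔ RegularSplitParameter S := by
  refine ⟨regularSplitParameter_of_twist (fun w => (μ w)⁻¹) hN.symm fun w x => ?_, regularSplitParameter_of_twist μ hN hρ⟩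
  rw [hρ, smul_smul, Units.val_inv_eq_inv_val, inv_mul_cancel₀ (μ w).ne_zero, one_smul]

/-- A regular split parameter has ABELIAN Weil image (all `S.ρ w` are simultaneously diagonal): the typed shadow of «principal series», used by
the probes to show the dial is a genuine restriction (a parameter with two non-commuting Weil elements — any irreducible constituent of dimension
≥ 2, e.g. every supercuspidal or induced-from-ramified-quadratic block — is NOT regularly refined). [folklore] -/
theorem RegularSplitParameter.commute {n : ℕ} {S : WeilDeligneRep F ℂ (Fin n → ℂ)} (h : RegularSplitParameter S)
    (w w' : WeilGroup F) : S.ρ w ∘ₗ S.ρ w' = S.ρ w' ∘ₗ S.ρ w := by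
  obtain ⟨-, b, χ, -, hdiag⟩ := h
  refine b.ext fun i => ?_
  simp only [LinearMap.coe_comp, Function.comp_apply, hdiag, map_smul, smul_smul, mul_comm]

/-- A regular split parameter has NO MONODROMY: the typed shadow of «not Steinberg / not special at v» (Newton 2015 §1.1's open case sits in the
complement). [folklore] -/
theorem RegularSplitParameter.N_eq_zero {n : ℕ} {S : WeilDeligneRep F ℂ (Fin n → ℂ)} (h : RegularSplitParameter S) : S.N = 0 := h.1

end Dial

/-- **The dial.** The cuspidal `π` (rank `n` over `K`) is REGULARLY REFINED at the finite place `v`: for every local component `π_v` of `π` at `v`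
(unique up to isomorphism — Flath, tree theorem `hasLocalComponentAt_unique_holds`) and EVERY local Langlands datum `L` of `K_v` (the summit
quantifies `∀ 𝓡`; Henniart's uniqueness is not in the tree, so the dial asks it of all data), every Frobenius-semisimple representative `S` of the class
`L.rec_n(π_v)` is a regular split parameter.  LOCAL AT `v`, GALOIS-FREE, `Rec`-FREE, FIELD-TYPE-FREE (critic rule f1, row 230). -/
def IsRegularlyRefinedAt {K : Type} [Field K] [NumberField K] {n : ℕ} {hcpt : isCompact_glFiniteIntegralLevel n K}
    (π : CuspidalAutomorphicRepData n K hcpt) (v : IsDedekindDomain.HeightOneSpectrum (NumberField.RingOfIntegers K)) : Prop :=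
  ∀ (πv : SmoothIrrep (Matrix.GeneralLinearGroup (Fin n) (v.adicCompletion K))), π.1.HasLocalComponentAt v πv.ρ →
    ∀ (L : LocalLanglandsDatum (v.adicCompletion K)) (S : WeilDeligneRep (v.adicCompletion K) ℂ (Fin n → ℂ)) (hS : S.IsFrobSemisimple),
      Quotient.mk (frobSemisimpleWDSetoid (v.adicCompletion K) n) ⟨S, hS⟩ = L.recGL n (IrrClass.mk πv) → RegularSplitParameter S

/-! ## Items of the child route `RefinementCarving` (texts = childroute.route.json VERBATIM; the dial is INLINED so that the route needs no new tree
definition — `refined_iff_named` / `unrefined_iff_named` identify the inlined texts with the named dial by `Iff.rfl`) -/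

/-- **REF — `RefinedIrregularCoreAtP`** [crux · rank 2 · NEW · WEAKER (kernel `Cert.ref_of_ri`; S-implied: `Cert.ref_of_langlands`) · leaf
ATTACKABLE-BY-ENGINE on the POLARISED WEAKLY-REGULAR ODD sector over the TR/CM floor (PRINT: Boxer–Pilloni Thm. 351 (4) gives BOTH halves — `ρ|K_v`
potentially crystalline and `ι WD(ρ|K_v)^{F-ss} = rec(π_v)` — conditional there on the endoscopic classification for unitary groups; NOT yet a tree
fact: `HilbertPartialWeightOneGaloisRep` «What is NOT here»; includes partial weight one Hilbert forms = the sector n = 2, K totally real, and the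
low-weight Siegel / U(a,b) cases of Jorza 2012 and Boxer–Pilloni) · IDEA-NEEDED off that sector (non-polarised irregular π, Hodge–Tate multiplicity ≥ 3:
no finite-slope family through π on which crystalline classical points ACCUMULATE is known — barrier B2 `ShimuraVarietyRealizationBarrier` technique
class (coherent cohomology needs a Shimura variety and a (limit of) discrete series); BC-collapse penumbra feeds UNREF, see there)]
RI restricted to the pairs (π, v ∣ ℓ) at which π is REGULARLY REFINED (inlined `IsRegularlyRefinedAt π v`): the ℓ-adic avatar ρ is de Rham at v
(DR half) and WD(ρ|K_v)^ss has the traces of rec_v(π_v) (S_p half).  The cell on which the p-adic-limit barrier's OWN evasion — Kisin's closed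
crystalline-period condition — has full strength: n distinct refinements give n independent periods, hence `dim D_cris = n` after the limit. -/
def RefinedIrregularCoreAtP : Prop :=
  (∀ (K : Type) [Field K] [NumberField K] (n : ℕ) (hcpt : Literature.NumberTheory.Automorphic.isCompact_glFiniteIntegralLevel n K), 0 < n → ∀ (π : Literature.NumberTheory.Automorphic.CuspidalAutomorphicRepData n K hcpt), π.1.IsLAlgebraic → Summit.Langlands.Langlands.Theorems.InsolubleInduction.SolvablyReachable K → 2 ≤ n → ¬ (∃ T : Literature.NumberTheory.Automorphic.InfinityType K n, π.1.HasInfinityType T ∧ T.IsLAlgebraic ∧ T.IsRegular) → ∀ (ℓ : ℕ) [Fact ℓ.Prime] (ι : PadicAlgCl ℓ ≃+* ℂ) (ρ : Literature.NumberTheory.GaloisRepresentations.FramedGaloisRep K (PadicAlgCl ℓ) n), ρ.toGaloisRep.IsIrreducible → (∀ᶠ v : IsDedekindDomain.HeightOneSpectrum (NumberField.RingOfIntegers K) in cofinite, SatakeFrobCompatibleAt ι π.1 ρ v) → ∀ (v : IsDedekindDomain.HeightOneSpectrum (NumberField.RingOfIntegers K)) (hv : ((ℓ : ℕ) : NumberField.RingOfIntegers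 K) ∈ v.asIdeal), (∀ (πv : Literature.NumberTheory.Automorphic.SmoothIrrep (Matrix.GeneralLinearGroup (Fin n) (v.adicCompletion K))), π.1.HasLocalComponentAt v πv.ρ → ∀ (L : Literature.NumberTheory.Automorphic.LocalLanglandsDatum (v.adicCompletion K)) (S : Literature.NumberTheory.GaloisRepresentations.WeilDeligneRep (v.adicCompletion K) ℂ (Fin n → ℂ)) (hS : S.IsFrobSemisimple), Quotient.mk (Literature.NumberTheory.Automorphic.frobSemisimpleWDSetoid (v.adicCompletion K) n) ⟨S, hS⟩ = L.recGL n (Literature.NumberTheory.Automorphic.IrrClass.mk πv) → (S.N = 0 ∧ ∃ (b : Module.Basis (Fin n) ℂ (Fin n → ℂ)) (χ : Fin n → Literature.NumberTheory.GaloisRepresentations.WeilGroup (v.adicCompletion K) → ℂ), Function.Injective χ ∧ ∀ (i : Fin n) (w : Literature.NumberTheory.GaloisRepresentations.WeilGroup (v.adicCompletion K)), S.ρ w (b i) = χ i w • b i)) → (Literature.NumberTheory.PAdicHodge.fontainePstAdicCompletion v ℓ hv).IsDeRhamFramed (ρ.toLocal v)) ∧ (∀ (K : Type) [Field K] [NumberField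 K] (Rec : ReciprocityData K) (n : ℕ) (hcpt : Literature.NumberTheory.Automorphic.isCompact_glFiniteIntegralLevel n K), 0 < n → ∀ (π : Literature.NumberTheory.Automorphic.CuspidalAutomorphicRepData n K hcpt), π.1.IsLAlgebraic → Summit.Langlands.Langlands.Theorems.InsolubleInduction.SolvablyReachable K → 2 ≤ n → ¬ (∃ T : Literature.NumberTheory.Automorphic.InfinityType K n, π.1.HasInfinityType T ∧ T.IsLAlgebraic ∧ T.IsRegular) → ∀ (ℓ : ℕ) [Fact ℓ.Prime] (ι : PadicAlgCl ℓ ≃+* ℂ) (ρ : Literature.NumberTheory.GaloisRepresentations.FramedGaloisRep K (PadicAlgCl ℓ) n), ρ.toGaloisRep.IsIrreducible → ((∀ᶠ v : IsDedekindDomain.HeightOneSpectrum (NumberField.RingOfIntegers K) in Filter.cofinite, ρ.IsUnramifiedAt v) ∧ ∀ (v : IsDedekindDomain.HeightOneSpectrum (NumberField.RingOfIntegers K)) (hv : ((ℓ : ℕ) : NumberField.RingOfIntegers K) ∈ v.asIdeal), (Literature.NumberTheory.PAdicHodge.fontainePstAdicCompletion v ℓ hv).IsDeRhamFramed (ρ.toLocal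 v)) → (∀ᶠ v : IsDedekindDomain.HeightOneSpectrum (NumberField.RingOfIntegers K) in Filter.cofinite, SatakeFrobCompatibleAt ι π.1 ρ v) → ∀ (v : IsDedekindDomain.HeightOneSpectrum (NumberField.RingOfIntegers K)) (hv : ((ℓ : ℕ) : NumberField.RingOfIntegers K) ∈ v.asIdeal), (∀ (πv : Literature.NumberTheory.Automorphic.SmoothIrrep (Matrix.GeneralLinearGroup (Fin n) (v.adicCompletion K))), π.1.HasLocalComponentAt v πv.ρ → ∀ (L : Literature.NumberTheory.Automorphic.LocalLanglandsDatum (v.adicCompletion K)) (S : Literature.NumberTheory.GaloisRepresentations.WeilDeligneRep (v.adicCompletion K) ℂ (Fin n → ℂ)) (hS : S.IsFrobSemisimple), Quotient.mk (Literature.NumberTheory.Automorphic.frobSemisimpleWDSetoid (v.adicCompletion K) n) ⟨S, hS⟩ = L.recGL n (Literature.NumberTheory.Automorphic.IrrClass.mk πv) → (S.N = 0 ∧ ∃ (b : Module.Basis (Fin n) ℂ (Fin n → ℂ)) (χ : Fin n → Literature.NumberTheory.GaloisRepresentations.WeilGroup (v.adicCompletion K) → ℂ), Function.Injective χ ∧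 ∀ (i : Fin n) (w : Literature.NumberTheory.GaloisRepresentations.WeilGroup (v.adicCompletion K)), S.ρ w (b i) = χ i w • b i)) → ∃ (πv : Literature.NumberTheory.Automorphic.SmoothIrrep (Matrix.GeneralLinearGroup (Fin n) (v.adicCompletion K))) (r : Literature.NumberTheory.GaloisRepresentations.WeilDeligneRep (v.adicCompletion K) (PadicAlgCl ℓ) (Fin n → PadicAlgCl ℓ)) (rℂ : Literature.NumberTheory.GaloisRepresentations.WeilDeligneRep (v.adicCompletion K) ℂ (Fin n → ℂ)), π.1.HasLocalComponentAt v πv.ρ ∧ (Rec.pst ℓ v hv).IsWeilDeligneOf (ρ.toLocal v) r ∧ r.IsTransportAlong (ι : PadicAlgCl ℓ →+* ℂ) rℂ ∧ ∀ (S : Literature.NumberTheory.GaloisRepresentations.WeilDeligneRep (v.adicCompletion K) ℂ (Fin n → ℂ)) (hS : S.IsFrobSemisimple), Quotient.mk (Literature.NumberTheory.Automorphic.frobSemisimpleWDSetoid (v.adicCompletion K) n) ⟨S, hS⟩ = (Rec.llc v).recGL n (Literature.NumberTheory.Automorphic.IrrClass.mk πv) → ∀ w : Literature.NumberTheory.GaloisRepresentations.WeilGroup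 (v.adicCompletion K), LinearMap.trace ℂ (Fin n → ℂ) (rℂ.ρ w) = LinearMap.trace ℂ (Fin n → ℂ) (S.ρ w))

/-- **UNREF — `UnrefinedIrregularCoreAtP`** [crux · rank 3 · NEW · DECLARED RESIDUAL (D-0170) · WEAKER (kernel `Cert.unref_of_ri`; S-implied:
`Cert.unref_of_langlands`) · leaf IDEA-NEEDED · BARRIER `MonodromyNotClosedUnderPadicLimits` scope-caveat (a) HEAD-ON (at v ∣ ℓ «p-adic limits of de Rham
representations need not be de Rham», AHTW 2026 p. 5, and NO closed condition replacing Kisin's periods is known when the refinements collide or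
do not exist: Jorza 2012 p. 2 «the condition on the Satake parameters being distinct is structural to the argument; in fact, one doesn't even obtain
that the representation is Hodge–Tate without this assumption»; Newton 2015 §1.1 «to handle the remaining cases [π_v special] seems to require a new
idea»; Moy–Specter 2015 Rem. 1.1)]
RI restricted to the pairs (π, v ∣ ℓ) at which π is NOT regularly refined: rec(π_v) has monodromy (π_v Steinberg-type / special), or a
constituent of dimension ≥ 2 (supercuspidal support), or is a NON-regular principal series (colliding refinements: companion-point / critical-slope
phenomena).  DECLARED PENUMBRA (instrumentable by transport, not typable without a base-change API on `CuspidalAutomorphicRepData`): members that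
are solvable BASE CHANGES of REF-members one floor down (a regular `I(χ)` whose regularity collapses under `χ_i ↦ χ_i ∘ N_{L_w/K_v}`) are booked by
cyclic base change (Arthur–Clozel Thm 4.2/5.1; de Rham-ness and WD restrict); members that are AUTOMORPHIC INDUCTIONS from rank n/d over a solvable
L ⊃ K are booked from rank < n (AC Thm 6.2 + local AI = induction of parameters).  Dark core: everything else — no engine, no instrument beyond the
finite-image DR rung of the parent (`Cert.dr_rung_finiteImage` there). -/
def UnrefinedIrregularCoreAtP : Prop :=
  (∀ (K : Type) [Field K] [NumberField K] (n : ℕ) (hcpt : Literature.NumberTheory.Automorphic.isCompact_glFiniteIntegralLevel n K), 0 < n → ∀ (π : Literature.NumberTheory.Automorphic.CuspidalAutomorphicRepData n K hcpt), π.1.IsLAlgebraic → Summit.Langlands.Langlands.Theorems.InsolubleInduction.SolvablyReachable K → 2 ≤ n → ¬ (∃ T : Literature.NumberTheory.Automorphic.InfinityType K n, π.1.HasInfinityType T ∧ T.IsLAlgebraic ∧ T.IsRegular) → ∀ (ℓ : ℕ) [Fact ℓ.Prime] (ι : PadicAlgCl ℓ ≃+* ℂ) (ρ : Literature.NumberTheory.GaloisRepresentations.FramedGaloisRep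 K (PadicAlgCl ℓ) n), ρ.toGaloisRep.IsIrreducible → (∀ᶠ v : IsDedekindDomain.HeightOneSpectrum (NumberField.RingOfIntegers K) in cofinite, SatakeFrobCompatibleAt ι π.1 ρ v) → ∀ (v : IsDedekindDomain.HeightOneSpectrum (NumberField.RingOfIntegers K)) (hv : ((ℓ : ℕ) : NumberField.RingOfIntegers K) ∈ v.asIdeal), ¬ (∀ (πv : Literature.NumberTheory.Automorphic.SmoothIrrep (Matrix.GeneralLinearGroup (Fin n) (v.adicCompletion K))), π.1.HasLocalComponentAt v πv.ρ → ∀ (L : Literature.NumberTheory.Automorphic.LocalLanglandsDatum (v.adicCompletion K)) (S : Literature.NumberTheory.GaloisRepresentations.WeilDeligneRep (v.adicCompletion K) ℂ (Fin n → ℂ)) (hS : S.IsFrobSemisimple), Quotient.mk (Literature.NumberTheory.Automorphic.frobSemisimpleWDSetoid (v.adicCompletion K) n) ⟨S, hS⟩ = L.recGL n (Literature.NumberTheory.Automorphic.IrrClass.mk πv) → (S.N = 0 ∧ ∃ (b : Module.Basis (Fin n) ℂ (Fin n → ℂ)) (χ : Fin n → Literature.NumberTheory.GaloisRepresentations.WeilGroup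 (v.adicCompletion K) → ℂ), Function.Injective χ ∧ ∀ (i : Fin n) (w : Literature.NumberTheory.GaloisRepresentations.WeilGroup (v.adicCompletion K)), S.ρ w (b i) = χ i w • b i)) → (Literature.NumberTheory.PAdicHodge.fontainePstAdicCompletion v ℓ hv).IsDeRhamFramed (ρ.toLocal v)) ∧ (∀ (K : Type) [Field K] [NumberField K] (Rec : ReciprocityData K) (n : ℕ) (hcpt : Literature.NumberTheory.Automorphic.isCompact_glFiniteIntegralLevel n K), 0 < n → ∀ (π : Literature.NumberTheory.Automorphic.CuspidalAutomorphicRepData n K hcpt), π.1.IsLAlgebraic → Summit.Langlands.Langlands.Theorems.InsolubleInduction.SolvablyReachable K → 2 ≤ n → ¬ (∃ T : Literature.NumberTheory.Automorphic.InfinityType K n, π.1.HasInfinityType T ∧ T.IsLAlgebraic ∧ T.IsRegular) → ∀ (ℓ : ℕ) [Fact ℓ.Prime] (ι : PadicAlgCl ℓ ≃+* ℂ) (ρ : Literature.NumberTheory.GaloisRepresentations.FramedGaloisRep K (PadicAlgCl ℓ) n), ρ.toGaloisRep.IsIrreducible → ((∀ᶠ v : IsDedekindDomain.HeightOneSpectrum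 (NumberField.RingOfIntegers K) in Filter.cofinite, ρ.IsUnramifiedAt v) ∧ ∀ (v : IsDedekindDomain.HeightOneSpectrum (NumberField.RingOfIntegers K)) (hv : ((ℓ : ℕ) : NumberField.RingOfIntegers K) ∈ v.asIdeal), (Literature.NumberTheory.PAdicHodge.fontainePstAdicCompletion v ℓ hv).IsDeRhamFramed (ρ.toLocal v)) → (∀ᶠ v : IsDedekindDomain.HeightOneSpectrum (NumberField.RingOfIntegers K) in Filter.cofinite, SatakeFrobCompatibleAt ι π.1 ρ v) → ∀ (v : IsDedekindDomain.HeightOneSpectrum (NumberField.RingOfIntegers K)) (hv : ((ℓ : ℕ) : NumberField.RingOfIntegers K) ∈ v.asIdeal), ¬ (∀ (πv : Literature.NumberTheory.Automorphic.SmoothIrrep (Matrix.GeneralLinearGroup (Fin n) (v.adicCompletion K))), π.1.HasLocalComponentAt v πv.ρ → ∀ (L : Literature.NumberTheory.Automorphic.LocalLanglandsDatum (v.adicCompletion K)) (S : Literature.NumberTheory.GaloisRepresentations.WeilDeligneRep (v.adicCompletion K) ℂ (Fin n → ℂ)) (hS : S.IsFrobSemisimple), Quotient.mk (Literature.NumberTheory.Automorphic.frobSemisimpleWDSetoid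 (v.adicCompletion K) n) ⟨S, hS⟩ = L.recGL n (Literature.NumberTheory.Automorphic.IrrClass.mk πv) → (S.N = 0 ∧ ∃ (b : Module.Basis (Fin n) ℂ (Fin n → ℂ)) (χ : Fin n → Literature.NumberTheory.GaloisRepresentations.WeilGroup (v.adicCompletion K) → ℂ), Function.Injective χ ∧ ∀ (i : Fin n) (w : Literature.NumberTheory.GaloisRepresentations.WeilGroup (v.adicCompletion K)), S.ρ w (b i) = χ i w • b i)) → ∃ (πv : Literature.NumberTheory.Automorphic.SmoothIrrep (Matrix.GeneralLinearGroup (Fin n) (v.adicCompletion K))) (r : Literature.NumberTheory.GaloisRepresentations.WeilDeligneRep (v.adicCompletion K) (PadicAlgCl ℓ) (Fin n → PadicAlgCl ℓ)) (rℂ : Literature.NumberTheory.GaloisRepresentations.WeilDeligneRep (v.adicCompletion K) ℂ (Fin n → ℂ)), π.1.HasLocalComponentAt v πv.ρ ∧ (Rec.pst ℓ v hv).IsWeilDeligneOf (ρ.toLocal v) r ∧ r.IsTransportAlong (ι : PadicAlgCl ℓ →+* ℂ) rℂ ∧ ∀ (S : Literature.NumberTheory.GaloisRepresentations.WeilDeligneRep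 (v.adicCompletion K) ℂ (Fin n → ℂ)) (hS : S.IsFrobSemisimple), Quotient.mk (Literature.NumberTheory.Automorphic.frobSemisimpleWDSetoid (v.adicCompletion K) n) ⟨S, hS⟩ = (Rec.llc v).recGL n (Literature.NumberTheory.Automorphic.IrrClass.mk πv) → ∀ w : Literature.NumberTheory.GaloisRepresentations.WeilGroup (v.adicCompletion K), LinearMap.trace ℂ (Fin n → ℂ) (rℂ.ρ w) = LinearMap.trace ℂ (Fin n → ℂ) (S.ρ w))

/-- [assembly · rank 1] REF → UNREF → RI (= `PadicReachabilityCarving.ReachableIrregularCoreAtP`, stmt-Langlands-26900, BY NAME); proved below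
(`assembly_holds := closes_child`); the child route's deciding theorem is `closes` of childroute.glue.lean (same term, self-contained). -/
def Assembly : Prop :=
  RefinedIrregularCoreAtP → UnrefinedIrregularCoreAtP → PadicReachabilityCarving.ReachableIrregularCoreAtP

/-- [assembly-via-frame · documentation of the V-F fallback] REF → UNREF → RB → UR → AB → FRAME → Langlands, the parent's four other binders BY NAME
(stmt-Langlands-26899 / 26901 / 26902 / 26903); proved below (`assemblyViaFrame_holds := closes`). -/
def AssemblyViaFrame : Prop :=
  RefinedIrregularCoreAtP → UnrefinedIrregularCoreAtP → PadicReachabilityCarving.ReachableRegularCoreAtP →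
    PadicReachabilityCarving.UnreachableCoreAtP → PadicReachabilityCarving.AbelianCoreAtP → PadicReachabilityCarving.PadicCoreFrame → _root_.Langlands

/-! ## The named form of the two cells (readability; `Iff.rfl` to the inlined item texts) -/

/-- REF with the dial written `IsRegularlyRefinedAt π v`. -/
def RefinedNamed : Prop :=
  (∀ (K : Type) [Field K] [NumberField K] (n : ℕ) (hcpt : Literature.NumberTheory.Automorphic.isCompact_glFiniteIntegralLevel n K), 0 < n → ∀ (π : Literature.NumberTheory.Automorphic.CuspidalAutomorphicRepData n K hcpt), π.1.IsLAlgebraic → Summit.Langlands.Langlands.Theorems.InsolubleInduction.SolvablyReachable K → 2 ≤ n → ¬ (∃ T : Literature.NumberTheory.Automorphic.InfinityType K n, π.1.HasInfinityType T ∧ T.IsLAlgebraic ∧ T.IsRegular) → ∀ (ℓ : ℕ) [Fact ℓ.Prime] (ι : PadicAlgCl ℓ ≃+* ℂ) (ρ : Literature.NumberTheory.GaloisRepresentations.FramedGaloisRep K (PadicAlgCl ℓ) n), ρ.toGaloisRep.IsIrreducible → (∀ᶠ v : IsDedekindDomain.HeightOneSpectrum (NumberField.RingOfIntegers K) in cofinite,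 SatakeFrobCompatibleAt ι π.1 ρ v) → ∀ (v : IsDedekindDomain.HeightOneSpectrum (NumberField.RingOfIntegers K)) (hv : ((ℓ : ℕ) : NumberField.RingOfIntegers K) ∈ v.asIdeal), Summit.Langlands.Langlands.Theorems.RefinementCarvingKernel.IsRegularlyRefinedAt π v → (Literature.NumberTheory.PAdicHodge.fontainePstAdicCompletion v ℓ hv).IsDeRhamFramed (ρ.toLocal v)) ∧ (∀ (K : Type) [Field K] [NumberField K] (Rec : ReciprocityData K) (n : ℕ) (hcpt : Literature.NumberTheory.Automorphic.isCompact_glFiniteIntegralLevel n K), 0 < n → ∀ (π : Literature.NumberTheory.Automorphic.CuspidalAutomorphicRepData n K hcpt), π.1.IsLAlgebraic → Summit.Langlands.Langlands.Theorems.InsolubleInduction.SolvablyReachable K → 2 ≤ n → ¬ (∃ T : Literature.NumberTheory.Automorphic.InfinityType K n, π.1.HasInfinityType T ∧ T.IsLAlgebraic ∧ T.IsRegular) → ∀ (ℓ : ℕ) [Fact ℓ.Prime] (ι : PadicAlgCl ℓ ≃+* ℂ) (ρ : Literature.NumberTheory.GaloisRepresentations.FramedGaloisRep K (PadicAlgCl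 ℓ) n), ρ.toGaloisRep.IsIrreducible → ((∀ᶠ v : IsDedekindDomain.HeightOneSpectrum (NumberField.RingOfIntegers K) in Filter.cofinite, ρ.IsUnramifiedAt v) ∧ ∀ (v : IsDedekindDomain.HeightOneSpectrum (NumberField.RingOfIntegers K)) (hv : ((ℓ : ℕ) : NumberField.RingOfIntegers K) ∈ v.asIdeal), (Literature.NumberTheory.PAdicHodge.fontainePstAdicCompletion v ℓ hv).IsDeRhamFramed (ρ.toLocal v)) → (∀ᶠ v : IsDedekindDomain.HeightOneSpectrum (NumberField.RingOfIntegers K) in Filter.cofinite, SatakeFrobCompatibleAt ι π.1 ρ v) → ∀ (v : IsDedekindDomain.HeightOneSpectrum (NumberField.RingOfIntegers K)) (hv : ((ℓ : ℕ) : NumberField.RingOfIntegers K) ∈ v.asIdeal), Summit.Langlands.Langlands.Theorems.RefinementCarvingKernel.IsRegularlyRefinedAt π v → ∃ (πv : Literature.NumberTheory.Automorphic.SmoothIrrep (Matrix.GeneralLinearGroup (Fin n) (v.adicCompletion K))) (r : Literature.NumberTheory.GaloisRepresentations.WeilDeligneRep (v.adicCompletion K) (PadicAlgCl ℓ) (Fin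 n → PadicAlgCl ℓ)) (rℂ : Literature.NumberTheory.GaloisRepresentations.WeilDeligneRep (v.adicCompletion K) ℂ (Fin n → ℂ)), π.1.HasLocalComponentAt v πv.ρ ∧ (Rec.pst ℓ v hv).IsWeilDeligneOf (ρ.toLocal v) r ∧ r.IsTransportAlong (ι : PadicAlgCl ℓ →+* ℂ) rℂ ∧ ∀ (S : Literature.NumberTheory.GaloisRepresentations.WeilDeligneRep (v.adicCompletion K) ℂ (Fin n → ℂ)) (hS : S.IsFrobSemisimple), Quotient.mk (Literature.NumberTheory.Automorphic.frobSemisimpleWDSetoid (v.adicCompletion K) n) ⟨S, hS⟩ = (Rec.llc v).recGL n (Literature.NumberTheory.Automorphic.IrrClass.mk πv) → ∀ w : Literature.NumberTheory.GaloisRepresentations.WeilGroup (v.adicCompletion K), LinearMap.trace ℂ (Fin n → ℂ) (rℂ.ρ w) = LinearMap.trace ℂ (Fin n → ℂ) (S.ρ w))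

/-- UNREF with the dial written `¬ IsRegularlyRefinedAt π v`. -/
def UnrefinedNamed : Prop :=
  (∀ (K : Type) [Field K] [NumberField K] (n : ℕ) (hcpt : Literature.NumberTheory.Automorphic.isCompact_glFiniteIntegralLevel n K), 0 < n → ∀ (π : Literature.NumberTheory.Automorphic.CuspidalAutomorphicRepData n K hcpt), π.1.IsLAlgebraic → Summit.Langlands.Langlands.Theorems.InsolubleInduction.SolvablyReachable K → 2 ≤ n → ¬ (∃ T : Literature.NumberTheory.Automorphic.InfinityType K n, π.1.HasInfinityType T ∧ T.IsLAlgebraic ∧ T.IsRegular) → ∀ (ℓ : ℕ) [Fact ℓ.Prime] (ι : PadicAlgCl ℓ ≃+* ℂ) (ρ : Literature.NumberTheory.GaloisRepresentations.FramedGaloisRep K (PadicAlgCl ℓ) n), ρ.toGaloisRep.IsIrreducible → (∀ᶠ v : IsDedekindDomain.HeightOneSpectrum (NumberField.RingOfIntegers K) in cofinite, SatakeFrobCompatibleAt ι π.1 ρ v) → ∀ (v : IsDedekindDomain.HeightOneSpectrum (NumberField.RingOfIntegers K)) (hv : ((ℓ : ℕ) : NumberField.RingOfIntegers K) ∈ v.asIdeal),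 ¬ Summit.Langlands.Langlands.Theorems.RefinementCarvingKernel.IsRegularlyRefinedAt π v → (Literature.NumberTheory.PAdicHodge.fontainePstAdicCompletion v ℓ hv).IsDeRhamFramed (ρ.toLocal v)) ∧ (∀ (K : Type) [Field K] [NumberField K] (Rec : ReciprocityData K) (n : ℕ) (hcpt : Literature.NumberTheory.Automorphic.isCompact_glFiniteIntegralLevel n K), 0 < n → ∀ (π : Literature.NumberTheory.Automorphic.CuspidalAutomorphicRepData n K hcpt), π.1.IsLAlgebraic → Summit.Langlands.Langlands.Theorems.InsolubleInduction.SolvablyReachable K → 2 ≤ n → ¬ (∃ T : Literature.NumberTheory.Automorphic.InfinityType K n, π.1.HasInfinityType T ∧ T.IsLAlgebraic ∧ T.IsRegular) → ∀ (ℓ : ℕ) [Fact ℓ.Prime] (ι : PadicAlgCl ℓ ≃+* ℂ) (ρ : Literature.NumberTheory.GaloisRepresentations.FramedGaloisRep K (PadicAlgCl ℓ) n), ρ.toGaloisRep.IsIrreducible → ((∀ᶠ v : IsDedekindDomain.HeightOneSpectrum (NumberField.RingOfIntegers K) in Filter.cofinite, ρ.IsUnramifiedAt v) ∧ ∀ (v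 : IsDedekindDomain.HeightOneSpectrum (NumberField.RingOfIntegers K)) (hv : ((ℓ : ℕ) : NumberField.RingOfIntegers K) ∈ v.asIdeal), (Literature.NumberTheory.PAdicHodge.fontainePstAdicCompletion v ℓ hv).IsDeRhamFramed (ρ.toLocal v)) → (∀ᶠ v : IsDedekindDomain.HeightOneSpectrum (NumberField.RingOfIntegers K) in Filter.cofinite, SatakeFrobCompatibleAt ι π.1 ρ v) → ∀ (v : IsDedekindDomain.HeightOneSpectrum (NumberField.RingOfIntegers K)) (hv : ((ℓ : ℕ) : NumberField.RingOfIntegers K) ∈ v.asIdeal), ¬ Summit.Langlands.Langlands.Theorems.RefinementCarvingKernel.IsRegularlyRefinedAt π v → ∃ (πv : Literature.NumberTheory.Automorphic.SmoothIrrep (Matrix.GeneralLinearGroup (Fin n) (v.adicCompletion K))) (r : Literature.NumberTheory.GaloisRepresentations.WeilDeligneRep (v.adicCompletion K) (PadicAlgCl ℓ) (Fin n → PadicAlgCl ℓ)) (rℂ : Literature.NumberTheory.GaloisRepresentations.WeilDeligneRep (v.adicCompletion K) ℂ (Fin n → ℂ)), π.1.HasLocalComponentAt v πv.ρ ∧ (Rec.pst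 ℓ v hv).IsWeilDeligneOf (ρ.toLocal v) r ∧ r.IsTransportAlong (ι : PadicAlgCl ℓ →+* ℂ) rℂ ∧ ∀ (S : Literature.NumberTheory.GaloisRepresentations.WeilDeligneRep (v.adicCompletion K) ℂ (Fin n → ℂ)) (hS : S.IsFrobSemisimple), Quotient.mk (Literature.NumberTheory.Automorphic.frobSemisimpleWDSetoid (v.adicCompletion K) n) ⟨S, hS⟩ = (Rec.llc v).recGL n (Literature.NumberTheory.Automorphic.IrrClass.mk πv) → ∀ w : Literature.NumberTheory.GaloisRepresentations.WeilGroup (v.adicCompletion K), LinearMap.trace ℂ (Fin n → ℂ) (rℂ.ρ w) = LinearMap.trace ℂ (Fin n → ℂ) (S.ρ w))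

/-- REF in inlined form IS the named form (definitional). -/
theorem refined_iff_named : RefinedIrregularCoreAtP ↔ RefinedNamed := Iff.rfl

/-- UNREF in inlined form IS the named form (definitional). -/
theorem unrefined_iff_named : UnrefinedIrregularCoreAtP ↔ UnrefinedNamed := Iff.rfl

/-! ## Kernels — the carving is EXACT (one excluded middle on the dial), the child route decides RI, the root closes through the parent -/

section Kernels

/-- **RI ⟺ REF ∧ UNREF** — exact modulo NOTHING: pointwise excluded middle on «π regularly refined at v» in each half. -/
theorem ri_iff_cells : PadicReachabilityCarving.ReachableIrregularCoreAtP ↔ RefinedIrregularCoreAtP ∧ UnrefinedIrregularCoreAtP := by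
  constructor
  · intro h
    exact ⟨⟨fun K _ _ n hcpt hn π hL hR h2 hI ℓ _ ι ρ hirr hsat v hv _ => h.1 K n hcpt hn π hL hR h2 hI ℓ ι ρ hirr hsat v hv,
        fun K _ _ Rec n hcpt hn π hL hR h2 hI ℓ _ ι ρ hirr hgeo hsat v hv _ => h.2 K Rec n hcpt hn π hL hR h2 hI ℓ ι ρ hirr hgeo hsat v hv⟩,
      ⟨fun K _ _ n hcpt hn π hL hR h2 hI ℓ _ ι ρ hirr hsat v hv _ => h.1 K n hcpt hn π hL hR h2 hI ℓ ι ρ hirr hsat v hv,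
        fun K _ _ Rec n hcpt hn π hL hR h2 hI ℓ _ ι ρ hirr hgeo hsat v hv _ => h.2 K Rec n hcpt hn π hL hR h2 hI ℓ ι ρ hirr hgeo hsat v hv⟩⟩
  · rintro ⟨hRef, hUnref⟩
    exact ⟨fun K _ _ n hcpt hn π hL hR h2 hI ℓ _ ι ρ hirr hsat v hv =>
        (Classical.em _).elim (hRef.1 K n hcpt hn π hL hR h2 hI ℓ ι ρ hirr hsat v hv) (hUnref.1 K n hcpt hn π hL hR h2 hI ℓ ι ρ hirr hsat v hv),
      fun K _ _ Rec n hcpt hn π hL hR h2 hI ℓ _ ι ρ hirr hgeo hsat v hv =>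
        (Classical.em _).elim (hRef.2 K Rec n hcpt hn π hL hR h2 hI ℓ ι ρ hirr hgeo hsat v hv) (hUnref.2 K Rec n hcpt hn π hL hR h2 hI ℓ ι ρ hirr hgeo hsat v hv)⟩

/-- **The child route's deciding theorem** (= `childroute.glue.lean` `closes` VERBATIM up to the namespace): RI BY NAME from the two cells. -/
theorem closes_child (hRef : RefinedIrregularCoreAtP) (hUnref : UnrefinedIrregularCoreAtP) : PadicReachabilityCarving.ReachableIrregularCoreAtP :=
  ri_iff_cells.2 ⟨hRef, hUnref⟩

/-- **ROOT closes** (V-F fallback; = `siblingroute.glue.lean`): Langlands from the two cells and the parent's four other binders, through the PARENT'S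
OWN landed deciding theorem `PadicReachabilityCarving.closes` (tree, rev 0) — nothing re-proved. -/
theorem closes (hRef : RefinedIrregularCoreAtP) (hUnref : UnrefinedIrregularCoreAtP) (hRB : PadicReachabilityCarving.ReachableRegularCoreAtP)
    (hUR : PadicReachabilityCarving.UnreachableCoreAtP) (hAB : PadicReachabilityCarving.AbelianCoreAtP) (hF : PadicReachabilityCarving.PadicCoreFrame) :
    _root_.Langlands :=
  PadicReachabilityCarving.closes hAB hRB (closes_child hRef hUnref) hUR hF

/-- The child route's Assembly `REF → UNREF → RI` holds (kernel `closes_child`). -/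
theorem assembly_holds : Assembly := closes_child

/-- The V-F fallback Assembly `REF → UNREF → RB → UR → AB → FRAME → Langlands` holds (kernel `closes`). -/
theorem assemblyViaFrame_holds : AssemblyViaFrame := closes

/-- The host target T = DR ∧ S_p gives RI (restriction; verbatim the g19/g20 kernel shape). -/
theorem ri_of_host (hDR : RootDecomp2.DeRhamMember) (hSp : RootDecomp2.SemisimpleMatchingAtP) : PadicReachabilityCarving.ReachableIrregularCoreAtP :=
  ⟨fun K _ _ n hcpt hn π hL _ _ _ => hDR K n hcpt hn π hL, fun K _ _ Rec n hcpt hn π hL _ _ _ => hSp K Rec n hcpt hn π hL⟩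

end Kernels

/-! ## Cert — necessity certificates: every piece is implied by the summit (WEAKER-or-equal by kernel; strictly weaker by the probes) -/

namespace Cert

open _root_.Summit.Langlands.Langlands.Theorems

-- (the two Weil–Deligne trace lemmas of the node duplicate landed tree lemmas (`WeilDeligneRep.IsFrobSemisimplificationOf.trace_eq`,
-- `WeilDeligneRep.IsEquivalent.trace_eq`); they are inlined as `have`s in `semisimpleMatchingAtP_of_langlands` below, not restated)

/-- DR ⟸ Langlands (verbatim the g19/g20 certificate: (A) + landed avatar conjugacy + `isGeometricFramed_of_isConjugate`). -/
theorem deRhamMember_of_langlands (hLang : _root_.Langlands) : RootDecomp2.DeRhamMember := by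
  intro K _ _ n hcpt hn π hL ℓ _ ι ρ hirr hsat v hv
  obtain ⟨⟨Rec⟩, hGLC⟩ := hLang K
  obtain ⟨ρπ, hirrπ, hgeoπ, hcorrπ, -⟩ := (hGLC Rec n hn hcpt).1 π hL ℓ ι
  have hconj : IsConjugate ρπ ρ :=
    EisensteinDegreeShiftSectorComplement.stub_avatarConjugacy K n hcpt π ℓ ι ρπ ρ hirrπ hcorrπ.1 hsat
  exact (ReciprocityUpToIrreducibility.isGeometricFramed_of_isConjugate hgeoπ hconj).2 v hv

/-- S_p ⟸ Langlands ((A) + avatar conjugacy + `corresponds_of_isConjugate`; traces pass through the Frobenius-semisimplification and the class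
equality). -/
theorem semisimpleMatchingAtP_of_langlands (hLang : _root_.Langlands) : RootDecomp2.SemisimpleMatchingAtP := by
  intro K _ _ Rec n hcpt hn π hL ℓ _ ι ρ hirr hgeo hsat v hv
  obtain ⟨-, hGLC⟩ := hLang K
  obtain ⟨ρπ, hirrπ, -, hcorrπ, -⟩ := (hGLC Rec n hn hcpt).1 π hL ℓ ι
  have hconj : IsConjugate ρπ ρ :=
    EisensteinDegreeShiftSectorComplement.stub_avatarConjugacy K n hcpt π ℓ ι ρπ ρ hirrπ hcorrπ.1 hsat
  have hcorr : Corresponds Rec ι π.1 ρ := ReciprocityUpToIrreducibility.corresponds_of_isConjugate hcorrπ hconj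
  obtain ⟨πv, r, rℂ, hπv, -, hpst, htr, r₁, hr₁, hcl₁⟩ := hcorr.2 v
  refine ⟨πv, r, rℂ, hπv, hpst hv, htr, fun S hS hcl w => ?_⟩
  have he : r₁.IsEquivalent S := Quotient.exact (hcl₁.trans hcl.symm)
  -- Frobenius-semisimplification is trace-neutral; isomorphic Weil–Deligne representations have equal traces (inlined: the
  -- tree lemmas `WeilDeligneRep.IsFrobSemisimplificationOf.trace_eq` / `IsEquivalent.trace_eq` live in an unbuilt module)
  have h1 : LinearMap.trace ℂ (Fin n → ℂ) (r₁.ρ w) = LinearMap.trace ℂ (Fin n → ℂ) (rℂ.ρ w) := by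
    obtain ⟨m, hm, -, hw⟩ := (hr₁.2.2 w).2
    rw [hw, map_add, (LinearMap.isNilpotent_trace_of_isNilpotent hm).eq_zero, add_zero]
  have h2 : LinearMap.trace ℂ (Fin n → ℂ) (r₁.ρ w) = LinearMap.trace ℂ (Fin n → ℂ) (S.ρ w) := by
    obtain ⟨e⟩ := he
    rw [← Representation.Equiv.conj_apply_self w e.toRepEquiv, LinearMap.trace_conj']
  rw [← h1]
  exact h2

/-- RI ⟸ Langlands. -/
theorem ri_of_langlands (hLang : _root_.Langlands) : PadicReachabilityCarving.ReachableIrregularCoreAtP :=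
  ri_of_host (deRhamMember_of_langlands hLang) (semisimpleMatchingAtP_of_langlands hLang)

/-- REF ⟸ RI (WEAKER certificate). -/
theorem ref_of_ri (h : PadicReachabilityCarving.ReachableIrregularCoreAtP) : RefinedIrregularCoreAtP := (ri_iff_cells.1 h).1

/-- UNREF ⟸ RI (WEAKER certificate). -/
theorem unref_of_ri (h : PadicReachabilityCarving.ReachableIrregularCoreAtP) : UnrefinedIrregularCoreAtP := (ri_iff_cells.1 h).2

/-- REF ⟸ Langlands. -/
theorem ref_of_langlands (hLang : _root_.Langlands) : RefinedIrregularCoreAtP := ref_of_ri (ri_of_langlands hLang)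

/-- UNREF ⟸ Langlands. -/
theorem unref_of_langlands (hLang : _root_.Langlands) : UnrefinedIrregularCoreAtP := unref_of_ri (ri_of_langlands hLang)

/-- The whole carving is S-implied: the child route adds NO strength beyond the summit (no piece is a disguised strengthening). -/
theorem pieces_of_langlands (hLang : _root_.Langlands) : RefinedIrregularCoreAtP ∧ UnrefinedIrregularCoreAtP :=
  ⟨ref_of_langlands hLang, unref_of_langlands hLang⟩

/-! ### BC5 decided sub-rungs (witness of weakness, first decided rung of each cell)
The DR-half of each cell on the locus where `ρ|Γ_{K_v}` has FINITE IMAGE — every reachable `K`, every `n ≥ 2`, every irregular L-algebraic `π`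
(the Galois-type / Artin locus: weight-one-type forms; there `S` itself is OPEN — strong Artin for insoluble images, tree open item
`LevelOneDyadic.Liftable.InsolubleStrongArtin` — so the rung lies outside `S`'s known regime) — decided by the Literature theorem
`fontainePstAdicCompletion_isDeRhamFramed_of_finite_range` (finite image ⇒ de Rham; files `BdRFiniteImage`, `FontaineDpst`).  On the dial this is the
degenerate end of the period engine (all `n` refinements have slope 0 after a finite base change: potentially unramified ⇒ potentially crystalline). -/

/-- **BC5 rung of REF**: `RefinedIrregularCoreAtP`'s DR-half ∣ finite local image — DECIDED. -/
theorem ref_dr_rung_finiteImage :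
    ∀ (K : Type) [Field K] [NumberField K] (n : ℕ) (hcpt : Literature.NumberTheory.Automorphic.isCompact_glFiniteIntegralLevel n K), 0 < n → ∀ (π : Literature.NumberTheory.Automorphic.CuspidalAutomorphicRepData n K hcpt), π.1.IsLAlgebraic → Summit.Langlands.Langlands.Theorems.InsolubleInduction.SolvablyReachable K → 2 ≤ n → ¬ (∃ T : Literature.NumberTheory.Automorphic.InfinityType K n, π.1.HasInfinityType T ∧ T.IsLAlgebraic ∧ T.IsRegular) → ∀ (ℓ : ℕ) [Fact ℓ.Prime] (ι : PadicAlgCl ℓ ≃+* ℂ) (ρ : Literature.NumberTheory.GaloisRepresentations.FramedGaloisRep K (PadicAlgCl ℓ) n), ρ.toGaloisRep.IsIrreducible → (∀ᶠ v : IsDedekindDomain.HeightOneSpectrum (NumberField.RingOfIntegers K) in cofinite, SatakeFrobCompatibleAt ι π.1 ρ v) → ∀ (v : IsDedekindDomain.HeightOneSpectrum (NumberField.RingOfIntegers K)) (hv : ((ℓ : ℕ) : NumberField.RingOfIntegers K) ∈ v.asIdeal), (∀ (πv : Literature.NumberTheory.Automorphic.SmoothIrrep (Matrix.GeneralLinearGroup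 (Fin n) (v.adicCompletion K))), π.1.HasLocalComponentAt v πv.ρ → ∀ (L : Literature.NumberTheory.Automorphic.LocalLanglandsDatum (v.adicCompletion K)) (S : Literature.NumberTheory.GaloisRepresentations.WeilDeligneRep (v.adicCompletion K) ℂ (Fin n → ℂ)) (hS : S.IsFrobSemisimple), Quotient.mk (Literature.NumberTheory.Automorphic.frobSemisimpleWDSetoid (v.adicCompletion K) n) ⟨S, hS⟩ = L.recGL n (Literature.NumberTheory.Automorphic.IrrClass.mk πv) → (S.N = 0 ∧ ∃ (b : Module.Basis (Fin n) ℂ (Fin n → ℂ)) (χ : Fin n → Literature.NumberTheory.GaloisRepresentations.WeilGroup (v.adicCompletion K) → ℂ), Function.Injective χ ∧ ∀ (i : Fin n) (w : Literature.NumberTheory.GaloisRepresentations.WeilGroup (v.adicCompletion K)), S.ρ w (b i) = χ i w • b i)) → (Set.range (ρ.toLocal v)).Finite → (Literature.NumberTheory.PAdicHodge.fontainePstAdicCompletion v ℓ hv).IsDeRhamFramed (ρ.toLocal v) :=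
  fun K _ _ n hcpt hn π hL hR h2 hI ℓ _ ι ρ hirr hsat v hv _ hfin =>
    Literature.NumberTheory.PAdicHodge.fontainePstAdicCompletion_isDeRhamFramed_of_finite_range v ℓ hv _ hfin

/-- **BC5 rung of UNREF** (the residual's decided corner): `UnrefinedIrregularCoreAtP`'s DR-half ∣ finite local image — DECIDED. -/
theorem unref_dr_rung_finiteImage :
    ∀ (K : Type) [Field K] [NumberField K] (n : ℕ) (hcpt : Literature.NumberTheory.Automorphic.isCompact_glFiniteIntegralLevel n K), 0 < n → ∀ (π : Literature.NumberTheory.Automorphic.CuspidalAutomorphicRepData n K hcpt), π.1.IsLAlgebraic → Summit.Langlands.Langlands.Theorems.InsolubleInduction.SolvablyReachable K → 2 ≤ n → ¬ (∃ T : Literature.NumberTheory.Automorphic.InfinityType K n, π.1.HasInfinityType T ∧ T.IsLAlgebraic ∧ T.IsRegular) → ∀ (ℓ : ℕ) [Fact ℓ.Prime] (ι : PadicAlgCl ℓ ≃+* ℂ) (ρ : Literature.NumberTheory.GaloisRepresentations.FramedGaloisRep K (PadicAlgCl ℓ) n), ρ.toGaloisRep.IsIrreducible → (∀ᶠ v :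 IsDedekindDomain.HeightOneSpectrum (NumberField.RingOfIntegers K) in cofinite, SatakeFrobCompatibleAt ι π.1 ρ v) → ∀ (v : IsDedekindDomain.HeightOneSpectrum (NumberField.RingOfIntegers K)) (hv : ((ℓ : ℕ) : NumberField.RingOfIntegers K) ∈ v.asIdeal), ¬ (∀ (πv : Literature.NumberTheory.Automorphic.SmoothIrrep (Matrix.GeneralLinearGroup (Fin n) (v.adicCompletion K))), π.1.HasLocalComponentAt v πv.ρ → ∀ (L : Literature.NumberTheory.Automorphic.LocalLanglandsDatum (v.adicCompletion K)) (S : Literature.NumberTheory.GaloisRepresentations.WeilDeligneRep (v.adicCompletion K) ℂ (Fin n → ℂ)) (hS : S.IsFrobSemisimple), Quotient.mk (Literature.NumberTheory.Automorphic.frobSemisimpleWDSetoid (v.adicCompletion K) n) ⟨S, hS⟩ = L.recGL n (Literature.NumberTheory.Automorphic.IrrClass.mk πv) → (S.N = 0 ∧ ∃ (b : Module.Basis (Fin n) ℂ (Fin n → ℂ)) (χ : Fin n → Literature.NumberTheory.GaloisRepresentations.WeilGroup (v.adicCompletion K) → ℂ), Function.Injective χ ∧ ∀ (i : Fin n) (w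 : Literature.NumberTheory.GaloisRepresentations.WeilGroup (v.adicCompletion K)), S.ρ w (b i) = χ i w • b i)) → (Set.range (ρ.toLocal v)).Finite → (Literature.NumberTheory.PAdicHodge.fontainePstAdicCompletion v ℓ hv).IsDeRhamFramed (ρ.toLocal v) :=
  fun K _ _ n hcpt hn π hL hR h2 hI ℓ _ ι ρ hirr hsat v hv _ hfin =>
    Literature.NumberTheory.PAdicHodge.fontainePstAdicCompletion_isDeRhamFramed_of_finite_range v ℓ hv _ hfin

end Cert


/-! ## Bridges to the BORN route `Theses.RefinementCarving` (route-Langlands-RefinementCarving rev 0): the filed texts are this twin's cells, definitionally -/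

/-- The born route decl REF (stmt filed as `RefinementCarving.RefinedIrregularCoreAtP`) IS this twin's `RefinedIrregularCoreAtP`. -/
theorem refined_route_iff_twin :
    Summit.Langlands.Langlands.Theses.RefinementCarving.RefinedIrregularCoreAtP ↔ RefinedIrregularCoreAtP := Iff.rfl

/-- The born route decl UNREF (`RefinementCarving.UnrefinedIrregularCoreAtP`) IS this twin's `UnrefinedIrregularCoreAtP`. -/
theorem unrefined_route_iff_twin :
    Summit.Langlands.Langlands.Theses.RefinementCarving.UnrefinedIrregularCoreAtP ↔ UnrefinedIrregularCoreAtP := Iff.rfl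

/-- The born route's Assembly (`RefinementCarving.Assembly`, stmt-Langlands-27214) IS this twin's `Assembly`. -/
theorem assembly_route_iff_twin :
    Summit.Langlands.Langlands.Theses.RefinementCarving.Assembly ↔ Assembly := Iff.rfl

/-- EXACTNESS for the born decls: RI ↔ REF ∧ UNREF with the route's own cells. -/
theorem ri_iff_route_cells :
    PadicReachabilityCarving.ReachableIrregularCoreAtP ↔
      Summit.Langlands.Langlands.Theses.RefinementCarving.RefinedIrregularCoreAtP ∧
        Summit.Langlands.Langlands.Theses.RefinementCarving.UnrefinedIrregularCoreAtP :=
  ri_iff_cells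

/-- Necessity for the born decls: the summit implies both cells of the route. -/
theorem route_pieces_of_langlands (hLang : _root_.Langlands) :
    Summit.Langlands.Langlands.Theses.RefinementCarving.RefinedIrregularCoreAtP ∧
      Summit.Langlands.Langlands.Theses.RefinementCarving.UnrefinedIrregularCoreAtP :=
  Cert.pieces_of_langlands hLang

end Summit.Langlands.Langlands.Theorems.RefinementCarvingKernel
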